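import Summits.CriticalPhenomena.PercolationContinuityZ3.Theorems.PercNonProliferationSubpolynomialBlockingStubCruxIffWallPatch
import Summits.CriticalPhenomena.PercolationContinuityZ3.Theorems.PercNonProliferationSubpolynomialBlockingStubBlockProbRatioMono
import Summits.CriticalPhenomena.PercolationContinuityZ3.Theorems.PercNonProliferationSubpolynomialBlockingStubEnclosureOfBlockingSubpatch
import HarnessLib

/-!
# Crux `PercNonProliferation.SubpolynomialBlocking` (stmt-CriticalPhenomena-4446), line `root-trick-wall-patch` —
# ASPECT-RATIO INDEPENDENCE of the crux, every ratio `R ≥ 2`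

Lead c3. The inputs are landed and imported: `stub_enclosureOfBlockingSubpatch` (sub-patch enclosure),
`stub_blockProbRatio_mono` (p116315), `subpolynomialBlocking_of_wallPatchEnclosure` (p115776); `cruxIffRatioAll_of` keeps the
sub-patch enclosure as a hypothesis (glue only) and `stub_cruxIffRatioAll` (registered signature) discharges it.

The crux is filed at aspect ratio 2: `u_n = u^{(2)}_n = P_{p_c}(Λ_n ↮ ∂ⁱⁿΛ_{2n} in Λ_{2n})`. For `R ≥ 1` put
`u^{(R)}_n = P_{p_c}(Λ_n ↮ ∂ⁱⁿΛ_{Rn} in Λ_{Rn})`; it increases with `R` (`stub_blockProbRatio_mono`, p116315), so the ratio-`R`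
statement `∀ s>0, ∀ᶠ n, n^{-s} ≤ u^{(R)}_n` gets WEAKER as `R` grows, and the standing disprover recorded `R ≥ 4` as the natural
repair candidates of the crux (Disproof §7b). **They are all equivalent to the crux.** The way back down from ratio `R` to ratio 2
goes through the wall: cover the wall patch `{0}×[0,r)²` by `R × R` sub-patches of side `t = ⌈r/R⌉`; a path from the patch to
sup-distance `4r` inside the half-space starts in some sub-patch, i.e. inside a translate `v + Λ_t` with `v` on the patch, and must
reach sup-distance `≥ 4r ≥ R t` from `v`, so it crosses the translated annulus `v + (Λ_{Rt} ∖ Λ_t)`; Harris over the `R²`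
translated (decreasing) blocking events gives `h(r) ≥ (u^{(R)}_t)^{R²}` (`stub_enclosureOfBlockingSubpatch`) — a FIXED power, so
sub-polynomiality transfers — and `h` sub-polynomial is the crux (`subpolynomialBlocking_of_wallPatchEnclosure`, p115776).
Consequence for the numerics: a plateau of the blocking probability at ANY fixed ratio (MC: ratio 4 ≈ 1.0·10⁻³ for
`8 ≤ n ≤ 24`; ratios 6/8/12/16 ≈ 0.02/0.08/0.19/0.26 on item 0846) is evidence for the crux itself; a polynomial decay at any
fixed ratio would refute it.
-/

noncomputable section

namespace Summit.CriticalPhenomena.PercolationContinuityZ3.Theorems.SubpolynomialBlocking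

open MeasureTheory Filter Topology
open Literature.Probability.Percolation Literature.Probability.LatticeModels
open Summit.CriticalPhenomena.PercolationContinuityZ3.Theorems.SubpolynomialBlocking.Negative

namespace StubCruxIffRatioAll

/-- Arithmetic of the sub-patch scale `t = ⌈r/R⌉ = (r + R - 1)/R`: for `2 ≤ R ≤ r`,
`1 ≤ t`, `r ≤ R t`, `R t ≤ 4 r` and `t ≤ r`. -/
theorem subpatch_scale {R r : ℕ} (hR : 2 ≤ R) (hr : R ≤ r) :
    1 ≤ (r + R - 1) / R ∧ r ≤ R * ((r + R - 1) / R) ∧ R * ((r + R - 1) / R) ≤ 4 * r ∧ (r + R - 1) / R ≤ r := by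
  have hR0 : 0 < R := by omega
  have h1 : R * ((r + R - 1) / R) ≤ r + R - 1 := Nat.mul_div_le (r + R - 1) R
  have h2 : r + R - 1 < R * ((r + R - 1) / R) + R := by
    have := Nat.lt_mul_div_succ (r + R - 1) hR0
    rw [Nat.mul_succ] at this
    exact this
  have h3 : 2 * r ≤ R * r := Nat.mul_le_mul_right r hR
  refine ⟨?_, by omega, by omega, ?_⟩
  · exact (Nat.le_div_iff_mul_le hR0).2 (by omega)
  · refine Nat.div_le_of_le_mul ?_
    calc r + R - 1 ≤ 2 * r := by omega
      _ ≤ R * r := h3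

/-- `⌈r/R⌉ → ∞` as `r → ∞` (`R ≥ 1`). -/
theorem tendsto_subpatch_scale {R : ℕ} (hR : 1 ≤ R) : Tendsto (fun r : ℕ => (r + R - 1) / R) atTop atTop := by
  refine tendsto_atTop_atTop.2 fun b => ⟨R * b, fun r hr => ?_⟩
  refine (Nat.le_div_iff_mul_le (by omega)).2 ?_
  calc b * R = R * b := Nat.mul_comm _ _
    _ ≤ r := hr
    _ ≤ r + R - 1 := by omega

/-- Real-analysis glue: `x^{-s} = (x^{-s/M})^M` for `x > 0`, `M ≥ 1`. -/
theorem rpow_neg_eq_pow_div {x : ℝ} (hx : 0 < x) (s : ℝ) {M : ℕ} (hM : 1 ≤ M) :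
    x ^ (-s) = (x ^ (-(s / M))) ^ M := by
  have hM0 : (M : ℝ) ≠ 0 := by exact_mod_cast (show M ≠ 0 by omega)
  rw [← Real.rpow_natCast, ← Real.rpow_mul hx.le]
  congr 1
  field_simp

end StubCruxIffRatioAll

/-- **Aspect-ratio independence of the crux, every `R ≥ 2`** (draft form: the sub-patch enclosure as a hypothesis): the crux
(ratio 2) holds iff the ratio-`R` critical annulus-blocking probability `u^{(R)}_n = P_{p_c}(Λ_n ↮ ∂ⁱⁿΛ_{Rn} in Λ_{Rn})` is
`≥ n^{-s}` eventually for every `s > 0`. -/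
theorem cruxIffRatioAll_of
    (hSub : ∀ R j t r : ℕ, 2 ≤ R → 1 ≤ t → r ≤ j * t → R * t ≤ 4 * r →
      (bondPercolation (zdGraph 3) (criticalProbI 3)).real {ω | ¬ ∃ x ∈ box 3 t,
        ∃ y ∈ innerBoundary (zdGraph 3) (box 3 (R * t)), ω ∈ openConnIn (↑(box 3 (R * t)) : Set (Site 3)) x y} ^ (j * j) ≤
      (bondPercolation (zdGraph 3) (criticalProbI 3)).real
          (openCrossing
            (Set.Icc (![0, -(4 * (r : ℤ)), -(4 * (r : ℤ))] : Site 3) ![4 * (r : ℤ), 5 * (r : ℤ) - 1, 5 * (r : ℤ) - 1])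
            {x : Site 3 | x 0 = 0 ∧ 0 ≤ x 1 ∧ x 1 < (r : ℤ) ∧ 0 ≤ x 2 ∧ x 2 < (r : ℤ)}
            {y : Site 3 | y ∈ Set.Icc (![0, -(4 * (r : ℤ)), -(4 * (r : ℤ))] : Site 3)
                ![4 * (r : ℤ), 5 * (r : ℤ) - 1, 5 * (r : ℤ) - 1] ∧
              (y 0 = 4 * (r : ℤ) ∨ y 1 = -(4 * (r : ℤ)) ∨ y 1 = 5 * (r : ℤ) - 1 ∨
                y 2 = -(4 * (r : ℤ)) ∨ y 2 = 5 * (r : ℤ) - 1)})ᶜ) :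
    ∀ R : ℕ, 2 ≤ R →
      (Summit.CriticalPhenomena.PercolationContinuityZ3.Theses.PercNonProliferation.SubpolynomialBlocking ↔
        ∀ s : ℝ, 0 < s → ∀ᶠ n : ℕ in atTop, (n : ℝ) ^ (-s) ≤
          (bondPercolation (zdGraph 3) (criticalProbI 3)).real {ω | ¬ ∃ x ∈ box 3 n,
            ∃ y ∈ innerBoundary (zdGraph 3) (box 3 (R * n)),
              ω ∈ openConnIn (↑(box 3 (R * n)) : Set (Site 3)) x y}) := by
  intro R hR2
  constructor
  · -- ratio 2 ⇒ ratio R, scale by scale (ratio monotonicity)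
    intro hcrux s hs
    have hu : ∀ᶠ n : ℕ in atTop, (n : ℝ) ^ (-s) ≤ blockProb 3 (criticalProbI 3) n :=
      (subpolynomialBlockingAt_iff 3 (criticalProbI 3)).1 (crux_iff.1 hcrux) s hs
    filter_upwards [hu] with n hn
    exact hn.trans (stub_blockProbRatio_mono 3 (criticalProbI 3) 2 R n (by norm_num) hR2)
  · -- ratio R ⇒ wall-patch enclosure sub-polynomial (fixed power R²) ⇒ crux
    intro hR
    refine subpolynomialBlocking_of_wallPatchEnclosure fun s hs => ?_
    have hM : 1 ≤ R * R := Nat.one_le_iff_ne_zero.2 (by positivity)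
    have hev := (StubCruxIffRatioAll.tendsto_subpatch_scale (R := R) (by omega)).eventually
      (hR (s / (R * R : ℕ)) (by positivity))
    filter_upwards [hev, eventually_ge_atTop R] with r hr hRr
    obtain ⟨ht1, hcov, hfit, htr⟩ := StubCruxIffRatioAll.subpatch_scale hR2 hRr
    set t : ℕ := (r + R - 1) / R with ht
    have ht0 : (0 : ℝ) < (t : ℝ) := by exact_mod_cast ht1
    have htr' : (t : ℝ) ≤ (r : ℝ) := by exact_mod_cast htr
    have hpow_nonneg : 0 ≤ (t : ℝ) ^ (-(s / (R * R : ℕ))) := Real.rpow_nonneg ht0.le _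
    calc (r : ℝ) ^ (-s) ≤ (t : ℝ) ^ (-s) := Real.rpow_le_rpow_of_nonpos ht0 htr' (by linarith)
      _ = ((t : ℝ) ^ (-(s / (R * R : ℕ)))) ^ (R * R) := StubCruxIffRatioAll.rpow_neg_eq_pow_div ht0 s hM
      _ ≤ _ := pow_le_pow_left₀ hpow_nonneg hr (R * R)
      _ ≤ _ := hSub R R t r hR2 ht1 hcov hfit

/-- **Aspect-ratio independence of the crux, every `R ≥ 2`** (registered on crux stmt-CriticalPhenomena-4446 as
`stub_cruxIffRatioAll`): the crux (ratio 2: `∀ s>0, ∀ᶠ n, n^{-s} ≤ P_{p_c}(Λ_n ↮ ∂ⁱⁿΛ_{2n} in Λ_{2n})`) holds iff the same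
sub-polynomial lower bound holds for the ratio-`R` critical annulus-blocking probability
`u^{(R)}_n = P_{p_c}(Λ_n ↮ ∂ⁱⁿΛ_{Rn} in Λ_{Rn})`. Since `u^{(R)}_n` increases with `R`, the ratio-`R` statements get formally weaker
as `R` grows (Disproof §7b recorded them as repair candidates); this theorem says none of them is actually weaker. `⇒`: ratio
monotonicity (`stub_blockProbRatio_mono`). `⇐`: `h(r) ≥ (u^{(R)}_{⌈r/R⌉})^{R²}` (`stub_enclosureOfBlockingSubpatch` with `j = R`,
`t = ⌈r/R⌉`), a fixed power, so `h` is sub-polynomial, which is the crux (`subpolynomialBlocking_of_wallPatchEnclosure`). -/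
theorem stub_cruxIffRatioAll : ∀ R : ℕ, 2 ≤ R → (Summit.CriticalPhenomena.PercolationContinuityZ3.Theses.PercNonProliferation.SubpolynomialBlocking ↔ ∀ s : ℝ, 0 < s → ∀ᶠ n : ℕ in atTop, (n : ℝ) ^ (-s) ≤ (bondPercolation (zdGraph 3) (criticalProbI 3)).real {ω | ¬ ∃ x ∈ box 3 n, ∃ y ∈ innerBoundary (zdGraph 3) (box 3 (R * n)), ω ∈ openConnIn (↑(box 3 (R * n)) : Set (Site 3)) x y}) :=
  cruxIffRatioAll_of stub_enclosureOfBlockingSubpatch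

/-- Corollary: the ratio-`R` statements are all equivalent to one another (`2 ≤ R, R'`). -/
theorem ratioSubpoly_iff_ratioSubpoly {R R' : ℕ} (hR : 2 ≤ R) (hR' : 2 ≤ R') :
    (∀ s : ℝ, 0 < s → ∀ᶠ n : ℕ in atTop, (n : ℝ) ^ (-s) ≤
        (bondPercolation (zdGraph 3) (criticalProbI 3)).real {ω | ¬ ∃ x ∈ box 3 n,
          ∃ y ∈ innerBoundary (zdGraph 3) (box 3 (R * n)), ω ∈ openConnIn (↑(box 3 (R * n)) : Set (Site 3)) x y}) ↔
      (∀ s : ℝ, 0 < s → ∀ᶠ n : ℕ in atTop, (n : ℝ) ^ (-s) ≤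
        (bondPercolation (zdGraph 3) (criticalProbI 3)).real {ω | ¬ ∃ x ∈ box 3 n,
          ∃ y ∈ innerBoundary (zdGraph 3) (box 3 (R' * n)), ω ∈ openConnIn (↑(box 3 (R' * n)) : Set (Site 3)) x y}) :=
  (stub_cruxIffRatioAll R hR).symm.trans (stub_cruxIffRatioAll R' hR')

end Summit.CriticalPhenomena.PercolationContinuityZ3.Theorems.SubpolynomialBlocking

end
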